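import Literature.MathematicalPhysics.QuantumFieldTheory.Balaban1983to89.B6MultiLevelTorusMirrorL0
import Literature.MathematicalPhysics.QuantumFieldTheory.Balaban1983to89.B4Eq242SignedImages

/-!
# `Balaban1983to89.B6MultiLevelTorusMirrorDirichlet` — [Balaban1984PropagatorsII] p. 229 / [Balaban1985BackgroundPropagators] p. 394: THE DIRICHLET GREEN's FUNCTION OF
# A `k′`-LEVEL OPERATOR `Δ′_a` ON A MIRROR BOX `X` IS THE SIGNED IMAGE SUM OF THE TORUS GREEN's FUNCTION OF THE REFLECTED FAMILY —
# `(X Δ′_a X)⁻¹(x, y) = Σ_ε (−1)^{|ε|} G′_refl(x, σ_ε y)` ([Balaban1983RegularityDecay] (2.42), signed), for EVERY `…L0` family, in exact arithmetic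

statement-level skeleton of published theorems with citation tags; proofs where landed; nothing here is a claim about the Yang–Mills mass gap

CITATION HEADER (lean-in-tree rule).  [4] = T. Bałaban, *Propagators and renormalization transformations for lattice gauge theories. II*, Commun. Math. Phys. **96**
(1984) 223–250 [`Balaban1984PropagatorsII`], (2.13)–(2.14) p. 225, p. 229 «If we are interested in a Green's function for this operator considered on a domain Ω ⊂ T_η,
we have to introduce some boundary conditions … Boundary conditions of this type can be interpreted as obtained by building an effective mass … up to +∞ outside Ω₁»;
[B9] = [`Balaban1985BackgroundPropagators`] p. 394 «the operator Δ′_a with Dirichlet boundary conditions on ∂Ω₀, i.e. the operator Δ′_a↾Ω₀ = Ω₀Δ′_aΩ₀ … Its inverse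
is denoted by G′ … They depend on the configuration U restricted to Ω₀»; [B4] = [`Balaban1983RegularityDecay`] (2.42) p. 584 (the multiple reflection method).

WHY THIS FILE (cell `pub-ymgap`, YM Track A D-0062, DAG node N06 = [B9], seat `pub-ymgap-dag-n06-c` g31; ROAD (I) «IMAGES» of LOCATED-31, file D3a; node00-def-Y g38
CUSTODIAN ANSWERS Q1/Q2, fleet INBOX 2026-08-31T11:47:00Z; dag-lead g44 «D1 → D2 → D3 GO, one pen»).  D1 (`B4Eq242SignedImages`) is the model-free identity, D2a
(`B4Eq242TorusMirrors`) the lattice layer, D2b (`B6MultiLevelTorusMirrorL0`) the reflected family `F′` of an arbitrary `…L0` family `F`.  THIS FILE verifies D1's four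
hypotheses for the torus operator `Δ′_a = mlOpT` of the reflected family — (i) `Δ′_a` of `F′` is INVARIANT under every face reflection (periodic Laplacian: D2a
`perLapT_trefl`; averaging kernels: the reflected levels are mirror-symmetric and the kernel grids `L^j` have the mirrors at block centres), (ii) an exterior site coupled
to the open box is a MIRROR site (Laplacian couplings reach torus neighbours only; averaging couplings stay inside the box under a half-block MARGIN binder) — and
concludes the EXACT Dirichlet identity on the doubled torus.  The row identification with `F`'s own operator on the embedded box and the decay fold (p33's census at
`reflectedIdx`) are D3b.

WHAT IS PROVED (0 `def`; theorems; 0 sorry; 0 new named facts; standard axioms).  Throughout `F : TDomains d ℓ Mh k P R`, `F.lev ≤ k′ ≤ k`, odd `L`, `M_h`, mirrored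
directions `mir`, widths `m_μ ≥ 2`, grid-aligned placement `g`, weights `a`; `N′ = N0 ℓ Mh k′ Pref`, `F′ = reflected F …`, `σ_ε = trefl …`, `X = mirBoxOpen …`.
* §1 `perLapT_entry_cases` (an off-diagonal nonzero entry of the periodic Laplacian joins torus neighbours), `avgK_trefl` (the averaging kernel of the reflected family is
  mirror-symmetric), ★ `mlOpT_reflected_trefl` — `Δ′_a(σx, σy) = Δ′_a(x, y)` for the reflected family and every face reflection.
* §2 ★ `exists_fixed_of_mlOpT_ne_zero` — under the MARGIN binder `hmarg` (the averaging block of an interior site of positive level lies inside the open box), an exterior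
  site coupled to an interior one by `Δ′_a` is fixed by a face reflection.
* §3 ★★★ `inv_compress_mlOpT_eq_signedImK` — `((Δ′_a)|_{X×X})⁻¹ = (Σ_{ε ≤ mir} (−1)^{#ε} G′(·, σ_ε ·))|_{X×X}` with `G′ = gmlT` the torus inverse of the reflected
  family's `Δ′_a` (weights `a_j > 0`); `compress_mlOpT_mul_signedImK` / `signedImK_mul_compress_mlOpT` (both products are `1`), `isUnit_compress_mlOpT`
  («G′ = (Δ′_a↾Ω₀)⁻¹ exists»), `inv_compress_mlOpT_mulVec` (the Dirichlet solution formula).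

PROOF.  Ours: D1's `inv_compress_eq_signedImK` at `ι = Fin (d+1) → Bool`, `Γ = mirIdx mir`, `σ = trefl`, `s = tsign ℝ mir`, `e = ⊥`, `T` = the mirrored directions,
`τ_μ = σ_{δ_μ}`, `m_μ = flipAt μ`, with (a) `mlOpT_mul_gmlT`, (b) `trefl_bot`/`tsign_bot`, (c) `trefl_not_mem_open`, (d) §1 + §2 + D2a's index bookkeeping.

HONEST SCOPE / NOT CLAIMED.  Exact linear algebra on the doubled torus; the MARGIN binder `hmarg` is displayed (the cube family discharges it by the choice of residues,
D3b/cube instance); no estimate ((2.67)/(3.42) for the Dirichlet letter is the census at `reflectedIdx` folded through D1 §4 — D3b); the identification of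
`(Δ′_a of F′)|_{X×X}` with `F`'s operator compressed to the embedded box is D3b.  Count-neutral; N06 NOT discharged; nothing on `d = 4`, the continuum, reflection
positivity, the mass gap or Clay.  No `sorry`, no `axiom`, no `def`, no `instance`, no `notation`.  Seat `pub-ymgap-dag-n06-c` g31, 2026-08-31;
`--supports stmt-QuantumFields-27239`.

RELATED IN THE TREE, NOT DUPLICATED (searched 2026-08-31, `rg` for `MirrorDirichlet|inv_compress_mlOpT|mlOpT_reflected_trefl` over `lean/Literature` + `lean/Summits`:
0 hits): D1/D2a/D2b (used by name); n05-c `B8Eq191FlatGreenDirichlet` (a flat Dirichlet Green's function CONSTRUCTED on `ℤ^d` by positivity — other carrier, no images);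
p21 `B4Reflection242.greenBox_*` (Neumann box via unsigned images of the free lattice).
-/

namespace Literature.MathematicalPhysics.QuantumFieldTheory.Balaban1983to89.B6MultiLevelTorusMirrorDirichlet

noncomputable section

open Finset Matrix
open Literature.MathematicalPhysics.QuantumFieldTheory.Balaban1983to89.B4Reflection242 (boxDom mem_boxDom blk avgK)
open Literature.MathematicalPhysics.QuantumFieldTheory.Balaban1983to89.B4TorusKernel.MultiPeriod (torusSupNorm torusSupNorm_le_supNorm)
open Literature.MathematicalPhysics.QuantumFieldTheory.Balaban1983to89.B4ContourShift (supNorm abs_le_supNorm)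
open Literature.MathematicalPhysics.QuantumFieldTheory.Balaban1983to89.B6MultiLevelBoxOperator (N0 bigSide levC)
open Literature.MathematicalPhysics.QuantumFieldTheory.Balaban1983to89.B6MultiLevelTorusOperator (twrap tshift perLapT shiftMat unitVec mlOpT gmlT mlOpT_mul_gmlT
  one_le_of_mem one_le_N0)
open Literature.MathematicalPhysics.QuantumFieldTheory.Balaban1983to89.B6MultiLevelTorusOperatorL0 (TDomains)
open Literature.MathematicalPhysics.QuantumFieldTheory.Balaban1983to89.B6Prop22KLevelTorusCensusL0 (KTIdx)
open Literature.MathematicalPhysics.QuantumFieldTheory.Balaban1983to89.B4Eq242TorusMirrors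
open Literature.MathematicalPhysics.QuantumFieldTheory.Balaban1983to89.B6MultiLevelTorusMirrorL0
open Literature.MathematicalPhysics.QuantumFieldTheory.Balaban1983to89.B4Eq242SignedImages (signedImK inv_compress_eq_signedImK compress_mul_signedImK
  signedImK_mul_compress)

variable {d ℓ Mh k R : ℕ} {P : Fin (d + 1) → ℕ}

/-! ## §1  The torus operator of the reflected family is invariant under the face reflections -/

section Invariance

variable {N : Fin (d + 1) → ℕ}

/-- an off-diagonal nonzero entry of the periodic Laplacian joins TORUS NEIGHBOURS (`y = x ± e_μ` on the torus).
[cite: Balaban1983RegularityDecay, (1.3) p.572 («periodic conditions»), bookkeeping] -/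
theorem perLapT_entry_cases {x y : ↥(boxDom N)} (hne : x ≠ y) (h : perLapT N x y ≠ 0) :
    ∃ μ, y = tshift N (unitVec μ) x ∨ y = tshift N (-unitVec μ) x := by
  by_contra hc
  push Not at hc
  apply h
  unfold perLapT shiftMat
  simp only [Matrix.sum_apply, Matrix.sub_apply, Matrix.smul_apply, Matrix.one_apply, smul_eq_mul]
  refine Finset.sum_eq_zero fun μ _ => ?_
  rw [if_neg hne, if_neg (hc μ).1, if_neg (hc μ).2]; ring

/-- a torus neighbour is at torus sup-distance `≤ 1`. [cite: Balaban1984PropagatorsII, (2.2) p.224 (torus distance), bookkeeping] -/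
theorem torusSupNorm_sub_le_one_of_neighbour {x y : ↥(boxDom N)} {μ : Fin (d + 1)}
    (h : y = tshift N (unitVec μ) x ∨ y = tshift N (-unitVec μ) x) : torusSupNorm N (x.1 - y.1) ≤ 1 := by
  have hN : ∀ i, 1 ≤ N i := one_le_of_mem x.2
  have hsup : ∀ v : Fin (d + 1) → ℤ, (∀ i, |v i| ≤ 1) → supNorm v ≤ 1 := fun v hv =>
    Finset.sup'_le _ _ fun i _ => by exact_mod_cast hv i
  have hu : ∀ i, |unitVec (d := d) μ i| ≤ 1 := fun i => by
    unfold unitVec; by_cases hi : i = μ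
    · subst hi; simp
    · simp [Pi.single_eq_of_ne hi]
  rw [show x.1 - y.1 = -(y.1 - x.1) by abel, B6Geom246MultiLevelTorus.torusSupNorm_neg hN]
  rcases h with h | h
  · rw [h]; exact (torusSupNorm_tshift_self_sub_le _ _).trans (hsup _ hu)
  · rw [h]; refine (torusSupNorm_tshift_self_sub_le _ _).trans (hsup _ fun i => ?_)
    rw [Pi.neg_apply, abs_neg]; exact hu i

end Invariance

section Reflected

variable {k' : ℕ} {mir : Fin (d + 1) → Bool} {m : Fin (d + 1) → ℕ}

/-- ★ THE AVERAGING KERNEL OF THE REFLECTED FAMILY IS MIRROR-SYMMETRIC: `[σy ∼_{j} σx] = [y ∼_{j} x]` for the block grid `L^j`, `j ≤ k′ + 1` (mirrors at `L^j`-block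
centres, D2b `hgrid_of_pow`). [cite: Balaban1984PropagatorsII, (2.14) p.225; Balaban1983RegularityDecay, (2.42) p.584] -/
theorem avgK_trefl (hL : Odd (ℓ + 1)) (hM : Odd Mh) (hMh : 1 ≤ Mh) (hm : ∀ μ, mir μ = true → 2 ≤ m μ)
    (c : ℝ) {j : ℕ} (hj : j ≤ k' + 1) (ε : Fin (d + 1) → Bool) (x y : ↥(boxDom (N0 ℓ Mh k' (Pref ℓ k k' P mir m)))) :
    avgK c ((ℓ + 1) ^ j) (trefl (hmir_of_top (k := k) (P := P) hL hM hMh hm) ε x).1 (trefl (hmir_of_top (k := k) (P := P) hL hM hMh hm) ε y).1 = avgK c ((ℓ + 1) ^ j) x.1 y.1 := by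
  have hgrid := hgrid_of_pow (k' := k') (m := m) hL hM hMh hm hj
  have hS : 0 < (ℓ + 1) ^ j := Nat.pow_pos (Nat.succ_pos ℓ)
  have hinv : ∀ z : ↥(boxDom (N0 ℓ Mh k' (Pref ℓ k k' P mir m))), trefl (hmir_of_top (k := k) (P := P) hL hM hMh hm) ε (trefl (hmir_of_top (k := k) (P := P) hL hM hMh hm) ε z) = z :=
    fun z => Subtype.ext (treflFun_treflFun (hmir_of_top (k := k) (P := P) hL hM hMh hm) ε z.2)
  unfold avgK
  have key : blk ((ℓ + 1) ^ j) (trefl (hmir_of_top (k := k) (P := P) hL hM hMh hm) ε y).1 = blk ((ℓ + 1) ^ j) (trefl (hmir_of_top (k := k) (P := P) hL hM hMh hm) ε x).1 ↔ blk ((ℓ + 1) ^ j) y.1 = blk ((ℓ + 1) ^ j) x.1 := by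
    constructor
    · intro h
      have h2 := blk_trefl_eq_of_blk_eq (hmir_of_top (k := k) (P := P) hL hM hMh hm) hS hgrid ε (x := trefl (hmir_of_top (k := k) (P := P) hL hM hMh hm) ε y) (y := trefl (hmir_of_top (k := k) (P := P) hL hM hMh hm) ε x) h
      rwa [hinv, hinv] at h2
    · intro h
      exact blk_trefl_eq_of_blk_eq (hmir_of_top (k := k) (P := P) hL hM hMh hm) hS hgrid ε h
  simp only [key]

/-- ★ **THE TORUS OPERATOR `Δ′_a` OF THE REFLECTED FAMILY IS INVARIANT UNDER EVERY FACE REFLECTION**: `Δ′_a(σx, σy) = Δ′_a(x, y)` — hypothesis (d)'s symmetry of D1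
(the reflected Green's function is then mirror-symmetric as well, D1 `submatrix_perm_eq_of_mul_eq_one`).
[cite: Balaban1984PropagatorsII, (2.13)–(2.14) p.225; Balaban1983RegularityDecay, (2.42) p.584] -/
theorem mlOpT_reflected_trefl {F : TDomains d ℓ Mh k P R} {k' : ℕ} {mir : Fin (d + 1) → Bool} {m : Fin (d + 1) → ℕ} {g : Fin (d + 1) → ℤ}
    {hL : Odd (ℓ + 1)} {hM : Odd Mh} {hMh : 1 ≤ Mh} {hP : ∀ μ, 1 ≤ P μ} {hk : k' ≤ k} {hlev : ∀ x, F.lev x ≤ k'}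
    {hm : ∀ μ, mir μ = true → 2 ≤ m μ} {hg : ∀ μ, sTop ℓ Mh k' ∣ g μ} (a : ℕ → ℝ) (ε : Fin (d + 1) → Bool) (x y : ↥(boxDom (N0 ℓ Mh k' (Pref ℓ k k' P mir m)))) :
    mlOpT (N0 ℓ Mh k' (Pref ℓ k k' P mir m)) ℓ k' (reflected F k' mir m g hL hM hMh hP hk hlev hm hg).lev a (trefl (hmir_of_top (k := k) (P := P) hL hM hMh hm) ε x) (trefl (hmir_of_top (k := k) (P := P) hL hM hMh hm) ε y) =
      mlOpT (N0 ℓ Mh k' (Pref ℓ k k' P mir m)) ℓ k' (reflected F k' mir m g hL hM hMh hP hk hlev hm hg).lev a x y := by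
  rw [B6MultiLevelTorusOperatorL0.mlOpT_apply (reflected F k' mir m g hL hM hMh hP hk hlev hm hg) rfl a, B6MultiLevelTorusOperatorL0.mlOpT_apply (reflected F k' mir m g hL hM hMh hP hk hlev hm hg) rfl a, perLapT_trefl, reflected_lev]
  have hl : levR F k' mir m g (hmir_of_top hL hM hMh hm) (trefl (hmir_of_top (k := k) (P := P) hL hM hMh hm) ε x).1 = levR F k' mir m g (hmir_of_top hL hM hMh hm) x.1 := levR_trefl ε x
  rw [hl]
  have hj : levR F k' mir m g (hmir_of_top hL hM hMh hm) x.1 ≤ k' + 1 := by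
    have := (reflected F k' mir m g hL hM hMh hP hk hlev hm hg).lev_le x.1
    rw [reflected_lev] at this; omega
  rw [avgK_trefl hL hM hMh hm _ hj]

/-! ## §2  No cross-coupling: an exterior site coupled to the open box is a mirror site -/

/-- ★ **NO CROSS-COUPLING**: under the MARGIN binder `hmarg` — the averaging block of every interior site lies inside the open mirror box — an exterior site `z` coupled
to an interior site `x` by `Δ′_a` of the reflected family (`Δ′_a(x, z) ≠ 0`) is a torus neighbour of `x`, hence (D2a `exists_fixed_of_near`) FIXED by a face reflection
— hypothesis (d) of D1. [cite: Balaban1985BackgroundPropagators, p.394 (Dirichlet boundary conditions on ∂Ω₀); Balaban1984PropagatorsII, (2.13)–(2.14) p.225] -/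
theorem exists_fixed_of_mlOpT_ne_zero {F : TDomains d ℓ Mh k P R} {k' : ℕ} {mir : Fin (d + 1) → Bool} {m : Fin (d + 1) → ℕ} {g : Fin (d + 1) → ℤ}
    {hL : Odd (ℓ + 1)} {hM : Odd Mh} {hMh : 1 ≤ Mh} {hP : ∀ μ, 1 ≤ P μ} {hk : k' ≤ k} {hlev : ∀ x, F.lev x ≤ k'}
    {hm : ∀ μ, mir μ = true → 2 ≤ m μ} {hg : ∀ μ, sTop ℓ Mh k' ∣ g μ} (a : ℕ → ℝ)
    (hmarg : ∀ x : ↥(boxDom (N0 ℓ Mh k' (Pref ℓ k k' P mir m))),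
      x ∈ mirBoxOpen (N0 ℓ Mh k' (Pref ℓ k k' P mir m)) mir (nMir ℓ Mh k' m) (fun _ => hMir ℓ Mh k') →
      ∀ z : ↥(boxDom (N0 ℓ Mh k' (Pref ℓ k k' P mir m))),
        blk ((ℓ + 1) ^ (reflected F k' mir m g hL hM hMh hP hk hlev hm hg).lev x.1) z.1 = blk ((ℓ + 1) ^ (reflected F k' mir m g hL hM hMh hP hk hlev hm hg).lev x.1) x.1 →
        z ∈ mirBoxOpen (N0 ℓ Mh k' (Pref ℓ k k' P mir m)) mir (nMir ℓ Mh k' m) (fun _ => hMir ℓ Mh k'))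
    {x z : ↥(boxDom (N0 ℓ Mh k' (Pref ℓ k k' P mir m)))}
    (hx : x ∈ mirBoxOpen (N0 ℓ Mh k' (Pref ℓ k k' P mir m)) mir (nMir ℓ Mh k' m) (fun _ => hMir ℓ Mh k'))
    (hz : z ∉ mirBoxOpen (N0 ℓ Mh k' (Pref ℓ k k' P mir m)) mir (nMir ℓ Mh k' m) (fun _ => hMir ℓ Mh k'))
    (h : mlOpT (N0 ℓ Mh k' (Pref ℓ k k' P mir m)) ℓ k' (reflected F k' mir m g hL hM hMh hP hk hlev hm hg).lev a x z ≠ 0) :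
    ∃ μ, mir μ = true ∧ trefl (hmir_of_top (k := k) (P := P) hL hM hMh hm) (single μ) z = z := by
  rw [B6MultiLevelTorusOperatorL0.mlOpT_apply (reflected F k' mir m g hL hM hMh hP hk hlev hm hg) rfl a] at h
  have hxz : x ≠ z := fun e => hz (e ▸ hx)
  -- the averaging coupling stays inside the box
  have havg : avgK (levC d ℓ a ((reflected F k' mir m g hL hM hMh hP hk hlev hm hg).lev x.1)) ((ℓ + 1) ^ (reflected F k' mir m g hL hM hMh hP hk hlev hm hg).lev x.1) x.1 z.1 = 0 := by
    unfold avgK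
    rw [if_neg]
    intro hb
    exact hz (hmarg x hx z hb)
  rw [havg, add_zero] at h
  obtain ⟨μ, hμ⟩ := perLapT_entry_cases hxz h
  exact exists_fixed_of_near (hmir_of_top (k := k) (P := P) hL hM hMh hm) hx hz (torusSupNorm_sub_le_one_of_neighbour hμ)

end Reflected

/-! ## §3  The Dirichlet identity on the doubled torus -/

section Identity

variable {k' : ℕ} {mir : Fin (d + 1) → Bool} {m : Fin (d + 1) → ℕ}

/-- the new torus is non-degenerate: `N′_μ ≥ 1`. [cite: Balaban1984PropagatorsII, (2.1) p.224, bookkeeping] -/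
theorem one_le_N0_Pref (hMh : 1 ≤ Mh) (hP : ∀ μ, 1 ≤ P μ) (hm : ∀ μ, mir μ = true → 2 ≤ m μ) :
    ∀ μ, 1 ≤ N0 ℓ Mh k' (Pref ℓ k k' P mir m) μ := by
  intro μ
  refine one_le_N0 hMh (fun ν => ?_) μ
  unfold Pref
  split_ifs with hν
  · have := hm ν hν; omega
  · exact le_trans (hP ν) (Nat.le_mul_of_pos_left _ (Nat.pow_pos (Nat.succ_pos ℓ)))

/-- ★★★ **THE DIRICHLET GREEN's FUNCTION BY SIGNED IMAGES** — for the torus operator `Δ′_a` of the reflected family (weights `a_j > 0`) and the open mirror box `X`: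
`(Δ′_a|_{X×X}) · K|_{X×X} = 1`, `K(x, y) = Σ_{ε ≤ mir} (−1)^{#ε} G′(x, σ_ε y)`, `G′ = Δ′_a⁻¹` on the doubled torus — under the margin binder `hmarg`.
[cite: Balaban1985BackgroundPropagators, p.394 («Δ′_a↾Ω₀ = Ω₀Δ′_aΩ₀ … Its inverse is denoted by G′»); Balaban1983RegularityDecay, (2.42) p.584; Balaban1984PropagatorsII, p.229] -/
theorem compress_mlOpT_mul_signedImK {F : TDomains d ℓ Mh k P R} {k' : ℕ} {mir : Fin (d + 1) → Bool} {m : Fin (d + 1) → ℕ} {g : Fin (d + 1) → ℤ}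
    {hL : Odd (ℓ + 1)} {hM : Odd Mh} {hMh : 1 ≤ Mh} {hP : ∀ μ, 1 ≤ P μ} {hk : k' ≤ k} {hlev : ∀ x, F.lev x ≤ k'}
    {hm : ∀ μ, mir μ = true → 2 ≤ m μ} {hg : ∀ μ, sTop ℓ Mh k' ∣ g μ} (a : ℕ → ℝ) (ha : ∀ j, 0 < a j)
    (hmarg : ∀ x : ↥(boxDom (N0 ℓ Mh k' (Pref ℓ k k' P mir m))),
      x ∈ mirBoxOpen (N0 ℓ Mh k' (Pref ℓ k k' P mir m)) mir (nMir ℓ Mh k' m) (fun _ => hMir ℓ Mh k') →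
      ∀ z : ↥(boxDom (N0 ℓ Mh k' (Pref ℓ k k' P mir m))),
        blk ((ℓ + 1) ^ (reflected F k' mir m g hL hM hMh hP hk hlev hm hg).lev x.1) z.1 = blk ((ℓ + 1) ^ (reflected F k' mir m g hL hM hMh hP hk hlev hm hg).lev x.1) x.1 →
        z ∈ mirBoxOpen (N0 ℓ Mh k' (Pref ℓ k k' P mir m)) mir (nMir ℓ Mh k' m) (fun _ => hMir ℓ Mh k')) :
    (mlOpT (N0 ℓ Mh k' (Pref ℓ k k' P mir m)) ℓ k' (reflected F k' mir m g hL hM hMh hP hk hlev hm hg).lev a).submatrix (fun v : ↥(mirBoxOpen (N0 ℓ Mh k' (Pref ℓ k k' P mir m)) mir (nMir ℓ Mh k' m) (fun _ => hMir ℓ Mh k')) => v.1) (fun v : ↥(mirBoxOpen (N0 ℓ Mh k' (Pref ℓ k k' P mir m)) mir (nMir ℓ Mh k' m) (fun _ => hMir ℓ Mh k')) => v.1) * (signedImK (mirIdx mir) (trefl (hmir_of_top (k := k) (P := P) hL hM hMh hm)) (tsign ℝ mir) (gmlT (N0 ℓ Mh k' (Pref ℓ k k' P mir m)) ℓ k'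 (reflected F k' mir m g hL hM hMh hP hk hlev hm hg).lev a)).submatrix (fun v : ↥(mirBoxOpen (N0 ℓ Mh k' (Pref ℓ k k' P mir m)) mir (nMir ℓ Mh k' m) (fun _ => hMir ℓ Mh k')) => v.1) (fun v : ↥(mirBoxOpen (N0 ℓ Mh k' (Pref ℓ k k' P mir m)) mir (nMir ℓ Mh k' m) (fun _ => hMir ℓ Mh k')) => v.1) = 1 := by
  classical
  refine compress_mul_signedImK _ (mlOpT_mul_gmlT (one_le_N0_Pref (k := k) (P := P) hMh hP hm) (reflected F k' mir m g hL hM hMh hP hk hlev hm hg).lev_le ha)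
    (mirIdx mir) _ (tsign ℝ mir) (e := fun _ => false) bot_mem_mirIdx (trefl_bot _) tsign_bot ?_
    (Finset.univ.filter fun μ => mir μ = true) (fun μ => trefl (hmir_of_top (k := k) (P := P) hL hM hMh hm) (single μ)) flipAt ?_ ?_
  · -- (c) freeness
    intro ε hε hne y hy
    exact trefl_not_mem_open _ hε hne hy
  · -- (d) mirrors: non-trivial, leave `Δ′_a` invariant, index involutions
    intro μ hμ
    rw [Finset.mem_filter] at hμ
    refine ⟨trefl_single_ne_one (one_le_N0_Pref (k := k) (P := P) hMh hP hm) _ hμ.2,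
      fun u w => mlOpT_reflected_trefl a (single μ) u w, fun ε hε => ?_⟩
    exact ⟨flipAt_mem_mirIdx hμ.2 hε, trefl_flipAt _ μ ε, tsign_flipAt hμ.2 ε, flipAt_flipAt μ ε⟩
  · -- no cross-coupling
    intro x hx z hz hA
    obtain ⟨μ, hμ, hfix⟩ := exists_fixed_of_mlOpT_ne_zero a hmarg hx hz hA
    exact ⟨μ, Finset.mem_filter.2 ⟨Finset.mem_univ _, hμ⟩, hfix⟩

/-- ★★★ the same on the other side: `K|_{X×X} · (Δ′_a|_{X×X}) = 1`. [cite: Balaban1985BackgroundPropagators, p.394; Balaban1983RegularityDecay, (2.42) p.584] -/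
theorem signedImK_mul_compress_mlOpT {F : TDomains d ℓ Mh k P R} {k' : ℕ} {mir : Fin (d + 1) → Bool} {m : Fin (d + 1) → ℕ} {g : Fin (d + 1) → ℤ}
    {hL : Odd (ℓ + 1)} {hM : Odd Mh} {hMh : 1 ≤ Mh} {hP : ∀ μ, 1 ≤ P μ} {hk : k' ≤ k} {hlev : ∀ x, F.lev x ≤ k'}
    {hm : ∀ μ, mir μ = true → 2 ≤ m μ} {hg : ∀ μ, sTop ℓ Mh k' ∣ g μ} (a : ℕ → ℝ) (ha : ∀ j, 0 < a j)
    (hmarg : ∀ x : ↥(boxDom (N0 ℓ Mh k' (Pref ℓ k k' P mir m))),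
      x ∈ mirBoxOpen (N0 ℓ Mh k' (Pref ℓ k k' P mir m)) mir (nMir ℓ Mh k' m) (fun _ => hMir ℓ Mh k') →
      ∀ z : ↥(boxDom (N0 ℓ Mh k' (Pref ℓ k k' P mir m))),
        blk ((ℓ + 1) ^ (reflected F k' mir m g hL hM hMh hP hk hlev hm hg).lev x.1) z.1 = blk ((ℓ + 1) ^ (reflected F k' mir m g hL hM hMh hP hk hlev hm hg).lev x.1) x.1 →
        z ∈ mirBoxOpen (N0 ℓ Mh k' (Pref ℓ k k' P mir m)) mir (nMir ℓ Mh k' m) (fun _ => hMir ℓ Mh k')) :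
    (signedImK (mirIdx mir) (trefl (hmir_of_top (k := k) (P := P) hL hM hMh hm)) (tsign ℝ mir) (gmlT (N0 ℓ Mh k' (Pref ℓ k k' P mir m)) ℓ k' (reflected F k' mir m g hL hM hMh hP hk hlev hm hg).lev a)).submatrix (fun v : ↥(mirBoxOpen (N0 ℓ Mh k' (Pref ℓ k k' P mir m)) mir (nMir ℓ Mh k' m) (fun _ => hMir ℓ Mh k')) => v.1) (fun v : ↥(mirBoxOpen (N0 ℓ Mh k' (Pref ℓ k k' P mir m)) mir (nMir ℓ Mh k' m) (fun _ => hMir ℓ Mh k')) => v.1) * (mlOpT (N0 ℓ Mh k' (Pref ℓ k k' P mir m)) ℓ k' (reflected F k' mir m g hL hM hMh hP hk hlev hm hg).lev a).submatrix (fun v : ↥(mirBoxOpen (N0 ℓ Mh k' (Pref ℓ k k' P mir m)) mir (nMir ℓ Mh k' m) (fun _ => hMir ℓ Mh k')) => v.1) (fun v : ↥(mirBoxOpen (N0 ℓ Mh k' (Pref ℓ k k' P mir m)) mir (nMir ℓ Mh k' m) (fun _ => hMir ℓ Mh k')) => v.1) = 1 :=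
  mul_eq_one_comm.1 (compress_mlOpT_mul_signedImK a ha hmarg)

/-- ★★★ **`(Δ′_a↾X)⁻¹ = K↾X`** — the Dirichlet Green's function of the mirror box IS the compressed signed image kernel of the reflected torus Green's function.
[cite: Balaban1985BackgroundPropagators, p.394 («Its inverse is denoted by G′»); Balaban1983RegularityDecay, (2.42) p.584; Balaban1984PropagatorsII, p.229] -/
theorem inv_compress_mlOpT_eq_signedImK {F : TDomains d ℓ Mh k P R} {k' : ℕ} {mir : Fin (d + 1) → Bool} {m : Fin (d + 1) → ℕ} {g : Fin (d + 1) → ℤ}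
    {hL : Odd (ℓ + 1)} {hM : Odd Mh} {hMh : 1 ≤ Mh} {hP : ∀ μ, 1 ≤ P μ} {hk : k' ≤ k} {hlev : ∀ x, F.lev x ≤ k'}
    {hm : ∀ μ, mir μ = true → 2 ≤ m μ} {hg : ∀ μ, sTop ℓ Mh k' ∣ g μ} (a : ℕ → ℝ) (ha : ∀ j, 0 < a j)
    (hmarg : ∀ x : ↥(boxDom (N0 ℓ Mh k' (Pref ℓ k k' P mir m))),
      x ∈ mirBoxOpen (N0 ℓ Mh k' (Pref ℓ k k' P mir m)) mir (nMir ℓ Mh k' m) (fun _ => hMir ℓ Mh k') →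
      ∀ z : ↥(boxDom (N0 ℓ Mh k' (Pref ℓ k k' P mir m))),
        blk ((ℓ + 1) ^ (reflected F k' mir m g hL hM hMh hP hk hlev hm hg).lev x.1) z.1 = blk ((ℓ + 1) ^ (reflected F k' mir m g hL hM hMh hP hk hlev hm hg).lev x.1) x.1 →
        z ∈ mirBoxOpen (N0 ℓ Mh k' (Pref ℓ k k' P mir m)) mir (nMir ℓ Mh k' m) (fun _ => hMir ℓ Mh k')) :
    ((mlOpT (N0 ℓ Mh k' (Pref ℓ k k' P mir m)) ℓ k' (reflected F k' mir m g hL hM hMh hP hk hlev hm hg).lev a).submatrix (fun v : ↥(mirBoxOpen (N0 ℓ Mh k' (Pref ℓ k k' P mir m)) mir (nMir ℓ Mh k' m) (fun _ => hMir ℓ Mh k')) => v.1) (fun v : ↥(mirBoxOpen (N0 ℓ Mh k' (Pref ℓ k k' P mir m)) mir (nMir ℓ Mh k' m) (fun _ => hMir ℓ Mh k')) => v.1))⁻¹ = (signedImK (mirIdx mir) (trefl (hmir_of_top (k := k) (P := P) hL hM hMh hm)) (tsign ℝ mir) (gmlT (N0 ℓ Mh k' (Pref ℓ k k' P mir m))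 ℓ k' (reflected F k' mir m g hL hM hMh hP hk hlev hm hg).lev a)).submatrix (fun v : ↥(mirBoxOpen (N0 ℓ Mh k' (Pref ℓ k k' P mir m)) mir (nMir ℓ Mh k' m) (fun _ => hMir ℓ Mh k')) => v.1) (fun v : ↥(mirBoxOpen (N0 ℓ Mh k' (Pref ℓ k k' P mir m)) mir (nMir ℓ Mh k' m) (fun _ => hMir ℓ Mh k')) => v.1) :=
  Matrix.inv_eq_right_inv (compress_mlOpT_mul_signedImK a ha hmarg)

/-- ★ «G′ = (Δ′_a↾Ω₀)⁻¹ exists»: the Dirichlet compression is invertible. [cite: Balaban1985BackgroundPropagators, p.394; Balaban1984PropagatorsII, p.225] -/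
theorem isUnit_compress_mlOpT {F : TDomains d ℓ Mh k P R} {k' : ℕ} {mir : Fin (d + 1) → Bool} {m : Fin (d + 1) → ℕ} {g : Fin (d + 1) → ℤ}
    {hL : Odd (ℓ + 1)} {hM : Odd Mh} {hMh : 1 ≤ Mh} {hP : ∀ μ, 1 ≤ P μ} {hk : k' ≤ k} {hlev : ∀ x, F.lev x ≤ k'}
    {hm : ∀ μ, mir μ = true → 2 ≤ m μ} {hg : ∀ μ, sTop ℓ Mh k' ∣ g μ} (a : ℕ → ℝ) (ha : ∀ j, 0 < a j)
    (hmarg : ∀ x : ↥(boxDom (N0 ℓ Mh k' (Pref ℓ k k' P mir m))),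
      x ∈ mirBoxOpen (N0 ℓ Mh k' (Pref ℓ k k' P mir m)) mir (nMir ℓ Mh k' m) (fun _ => hMir ℓ Mh k') →
      ∀ z : ↥(boxDom (N0 ℓ Mh k' (Pref ℓ k k' P mir m))),
        blk ((ℓ + 1) ^ (reflected F k' mir m g hL hM hMh hP hk hlev hm hg).lev x.1) z.1 = blk ((ℓ + 1) ^ (reflected F k' mir m g hL hM hMh hP hk hlev hm hg).lev x.1) x.1 →
        z ∈ mirBoxOpen (N0 ℓ Mh k' (Pref ℓ k k' P mir m)) mir (nMir ℓ Mh k' m) (fun _ => hMir ℓ Mh k')) :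
    IsUnit ((mlOpT (N0 ℓ Mh k' (Pref ℓ k k' P mir m)) ℓ k' (reflected F k' mir m g hL hM hMh hP hk hlev hm hg).lev a).submatrix (fun v : ↥(mirBoxOpen (N0 ℓ Mh k' (Pref ℓ k k' P mir m)) mir (nMir ℓ Mh k' m) (fun _ => hMir ℓ Mh k')) => v.1) (fun v : ↥(mirBoxOpen (N0 ℓ Mh k' (Pref ℓ k k' P mir m)) mir (nMir ℓ Mh k' m) (fun _ => hMir ℓ Mh k')) => v.1)) :=
  ⟨⟨_, _, compress_mlOpT_mul_signedImK a ha hmarg, signedImK_mul_compress_mlOpT a ha hmarg⟩, rfl⟩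

/-- ★ **THE DIRICHLET SOLUTION FORMULA**: `((Δ′_a↾X)⁻¹ f)(x) = Σ_{y∈X} Σ_{ε ≤ mir} (−1)^{#ε} G′(x, σ_ε y) f(y)`.
[cite: Balaban1985BackgroundPropagators, p.394 (the Dirichlet inverse G′); Balaban1983RegularityDecay, (2.42) p.584] -/
theorem inv_compress_mlOpT_mulVec {F : TDomains d ℓ Mh k P R} {k' : ℕ} {mir : Fin (d + 1) → Bool} {m : Fin (d + 1) → ℕ} {g : Fin (d + 1) → ℤ}
    {hL : Odd (ℓ + 1)} {hM : Odd Mh} {hMh : 1 ≤ Mh} {hP : ∀ μ, 1 ≤ P μ} {hk : k' ≤ k} {hlev : ∀ x, F.lev x ≤ k'}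
    {hm : ∀ μ, mir μ = true → 2 ≤ m μ} {hg : ∀ μ, sTop ℓ Mh k' ∣ g μ} (a : ℕ → ℝ) (ha : ∀ j, 0 < a j)
    (hmarg : ∀ x : ↥(boxDom (N0 ℓ Mh k' (Pref ℓ k k' P mir m))),
      x ∈ mirBoxOpen (N0 ℓ Mh k' (Pref ℓ k k' P mir m)) mir (nMir ℓ Mh k' m) (fun _ => hMir ℓ Mh k') →
      ∀ z : ↥(boxDom (N0 ℓ Mh k' (Pref ℓ k k' P mir m))),
        blk ((ℓ + 1) ^ (reflected F k' mir m g hL hM hMh hP hk hlev hm hg).lev x.1) z.1 = blk ((ℓ + 1) ^ (reflected F k' mir m g hL hM hMh hP hk hlev hm hg).lev x.1) x.1 →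
        z ∈ mirBoxOpen (N0 ℓ Mh k' (Pref ℓ k k' P mir m)) mir (nMir ℓ Mh k' m) (fun _ => hMir ℓ Mh k'))
    (f : ↥(mirBoxOpen (N0 ℓ Mh k' (Pref ℓ k k' P mir m)) mir (nMir ℓ Mh k' m) (fun _ => hMir ℓ Mh k')) → ℝ) (x : ↥(mirBoxOpen (N0 ℓ Mh k' (Pref ℓ k k' P mir m)) mir (nMir ℓ Mh k' m) (fun _ => hMir ℓ Mh k'))) :
    (((mlOpT (N0 ℓ Mh k' (Pref ℓ k k' P mir m)) ℓ k' (reflected F k' mir m g hL hM hMh hP hk hlev hm hg).lev a).submatrix (fun v : ↥(mirBoxOpen (N0 ℓ Mh k' (Pref ℓ k k' P mir m)) mir (nMir ℓ Mh k' m) (fun _ => hMir ℓ Mh k')) => v.1) (fun v : ↥(mirBoxOpen (N0 ℓ Mh k' (Pref ℓ k k' P mir m)) mir (nMir ℓ Mh k' m) (fun _ => hMir ℓ Mh k')) => v.1))⁻¹ *ᵥ f) x =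
      ∑ y : ↥(mirBoxOpen (N0 ℓ Mh k' (Pref ℓ k k' P mir m)) mir (nMir ℓ Mh k' m) (fun _ => hMir ℓ Mh k')), (∑ ε ∈ mirIdx mir, tsign ℝ mir ε * (gmlT (N0 ℓ Mh k' (Pref ℓ k k' P mir m)) ℓ k' (reflected F k' mir m g hL hM hMh hP hk hlev hm hg).lev a) x.1 (trefl (hmir_of_top (k := k) (P := P) hL hM hMh hm) ε y.1)) * f y := by
  rw [inv_compress_mlOpT_eq_signedImK a ha hmarg, Matrix.mulVec]
  rfl

end Identity

end

end Literature.MathematicalPhysics.QuantumFieldTheory.Balaban1983to89.B6MultiLevelTorusMirrorDirichlet
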